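/-
search for candidate a priori estimates; no regularity claim

# K87a — (R33, algebra) AN EXPLICIT RULING VECTOR: the pointwise linear algebra (any dimension,
# then `Fin 3`)

Node of record (verbatim, unchanged): L-λ(q) =
`Summit.NavierStokesRegularity.FunctionalMining.TopEigHeatCoercivePos q := ∃ c > 0,`
`TopEigHeatCoercive q c` — OPEN for every real `q > 1`; (F2) killing family WANTED/OPEN. This
file decides NOTHING about the node: door (e) box, pure algebra over `ℝ`, no field, no torus.
DATA at a point (K83b/K84 dictionary): a unit axis `u` (`∑ uᵢ² = 1`), the first jet `c_{k,i}`,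
`a_l := ∑ⱼ uⱼ c_{j,l}`, a weight vector `w`, and the LEAF VECTOR
`Y_k := ∑ₗ w_l (c_{k,l} − a_l u_k)` (`= (M w)_k` for the leaf form `M` of K84 when the jet is
twist-free). FACTS: `u·Y = 0` (`|u| = 1`); `X·Y = 0` for every ruling jet direction `X`
(`u·X = 0`, `∑ₖ X_k c_{k,l} = 0`); on `Fin 3`, for `r := u × Y`: `u·r = 0`, `|X|² r = −(Y·(u×X)) X`
(explicit polynomial certificates), hence `∑ₖ r_k c_{k,l} = 0` whenever a ruling jet direction
`X ≠ 0` exists (K84: always) — `r` IS A RULING JET DIRECTION; `|r|² = |Y|²`; and if the jet is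
non-planar (`∑ₖ Z_k c_{k,i} ≠ 0` for some `Z ⊥ u`) then some coordinate weight `w = e_{l₀}` gives
`Y ≠ 0`, so `r ≠ 0`. K87b `NoGo.TopEigHeatRulingField` turns `r` into explicit smooth GLOBAL
ruling fields of the axis projector. HONEST PLACEMENT: Mathlib only (`Finset` sums,
`linear_combination`). [ours] No number of record moves (KERNEL `0.68261 ≤ C_lam ≤ 49/50` etc.
untouched); no 𝒦₀ row. NOT CLAIMED: anything about fields, rulings or the node.
FILING (prove seat g34, REQUEST #121): declarations byte-identical to the no-go seat's staged `TopEigHeatRulingFieldAlgebra.STAGING.lean` 63bd90cfbc952d60; this line is the only addition.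
-/
import Summits.NavierStokesRegularity.FunctionalMining.BiaxialSaintVenant
import HarnessLib

noncomputable section

namespace Summit.NavierStokesRegularity.FunctionalMining

namespace TopEig.Ruling

/-! ## 1. Any dimension: the leaf vector `Y_k = ∑ₗ w_l (c_{k,l} − a_l u_k)` -/

section LeafVec

variable {d : Type*} [Fintype d] {u : d → ℝ} {c : d → d → ℝ} {w Y : d → ℝ}
  (hY : ∀ k, Y k = ∑ l, w l * (c k l - (∑ j, u j * c j l) * u k))
include hY

/-- `|u| = 1` ⇒ `u·Y = 0`. [ours, bookkeeping] -/
theorem leafVec_dot_axis (hu1 : ∑ i, u i ^ 2 = 1) : ∑ k, u k * Y k = 0 := by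
  have h1 : ∑ k, u k * u k = 1 := by
    rw [← hu1]; exact Finset.sum_congr rfl fun k _ => by ring
  have hs : ∀ k, u k * Y k
      = ∑ l, (w l * (u k * c k l) - w l * (∑ j, u j * c j l) * (u k * u k)) := fun k => by
    rw [hY, Finset.mul_sum]; exact Finset.sum_congr rfl fun l _ => by ring
  simp only [hs]
  rw [Finset.sum_comm]
  refine Finset.sum_eq_zero fun l _ => ?_
  rw [Finset.sum_sub_distrib, ← Finset.mul_sum, ← Finset.mul_sum, h1]; ring

/-- A ruling jet direction `X` (`u·X = 0`, `∑ₖ X_k c_{k,l} = 0`) has `X·Y = 0`. [ours] -/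
theorem leafVec_dot_ruling {X : d → ℝ} (huX : ∑ i, u i * X i = 0)
    (hXc : ∀ l, ∑ k, X k * c k l = 0) : ∑ k, X k * Y k = 0 := by
  have h1 : ∑ k, X k * u k = 0 := by
    rw [← huX]; exact Finset.sum_congr rfl fun k _ => by ring
  have hs : ∀ k, X k * Y k
      = ∑ l, (w l * (X k * c k l) - w l * (∑ j, u j * c j l) * (X k * u k)) := fun k => by
    rw [hY, Finset.mul_sum]; exact Finset.sum_congr rfl fun l _ => by ring
  simp only [hs]
  rw [Finset.sum_comm]
  refine Finset.sum_eq_zero fun l _ => ?_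
  rw [Finset.sum_sub_distrib, ← Finset.mul_sum, ← Finset.mul_sum, h1, hXc l]; ring

omit hY in
/-- A NON-PLANAR jet (`Z ⊥ u` with `∑ₖ Z_k c_{k,i} ≠ 0` for some `i`) has a non-zero leaf form
entry `c_{k,l} − a_l u_k ≠ 0`. [ours] -/
theorem exists_leafEntry_ne_zero {Z : d → ℝ} (huZ : ∑ i, u i * Z i = 0)
    (hZ : ∃ i, ∑ k, Z k * c k i ≠ 0) : ∃ l k, c k l - (∑ j, u j * c j l) * u k ≠ 0 := by
  by_contra h
  simp only [not_exists, not_not, sub_eq_zero] at h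
  obtain ⟨i, hi⟩ := hZ
  apply hi
  have hZu : ∑ k, Z k * u k = 0 := by
    rw [← huZ]; exact Finset.sum_congr rfl fun k _ => by ring
  calc ∑ k, Z k * c k i = ∑ k, (∑ j, u j * c j i) * (Z k * u k) :=
        Finset.sum_congr rfl fun k _ => by rw [h i k]; ring
    _ = 0 := by rw [← Finset.mul_sum, hZu, mul_zero]

end LeafVec

/-! ## 2. `Fin 3`: the ruling vector `r = u × Y` -/

section Cross

variable {u X Y r : Fin 3 → ℝ} (hr0 : r 0 = u 1 * Y 2 - u 2 * Y 1)
  (hr1 : r 1 = u 2 * Y 0 - u 0 * Y 2) (hr2 : r 2 = u 0 * Y 1 - u 1 * Y 0)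
include hr0 hr1 hr2

/-- `u·(u × Y) = 0`. [bookkeeping] -/
theorem cross_dot_axis : ∑ i, u i * r i = 0 := by
  simp only [Fin.sum_univ_three, hr0, hr1, hr2]; ring

/-- Lagrange: `|u| = 1`, `u·Y = 0` ⇒ `|u × Y|² = |Y|²`. [bookkeeping] -/
theorem cross_normSq (hu1 : ∑ i, u i ^ 2 = 1) (huY : ∑ k, u k * Y k = 0) :
    ∑ i, r i ^ 2 = ∑ k, Y k ^ 2 := by
  simp only [Fin.sum_univ_three] at hu1 huY ⊢
  rw [hr0, hr1, hr2]
  linear_combination (Y 0 ^ 2 + Y 1 ^ 2 + Y 2 ^ 2) * hu1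
    + (-(u 0 * Y 0 + u 1 * Y 1 + u 2 * Y 2)) * huY

/-- `u × Y ≠ 0` when `Y ≠ 0` (`|u| = 1`, `u·Y = 0`). [bookkeeping] -/
theorem cross_ne_zero (hu1 : ∑ i, u i ^ 2 = 1) (huY : ∑ k, u k * Y k = 0) (hY0 : ∃ k, Y k ≠ 0) :
    ∃ i, r i ≠ 0 := by
  by_contra h
  simp only [not_exists, not_not] at h
  obtain ⟨k, hk⟩ := hY0
  have h0 : ∑ k, Y k ^ 2 = 0 := by
    rw [← cross_normSq hr0 hr1 hr2 hu1 huY]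
    exact Finset.sum_eq_zero fun i _ => by rw [h i]; ring
  exact hk (pow_eq_zero_iff two_ne_zero |>.mp
    ((Finset.sum_eq_zero_iff_of_nonneg fun i _ => sq_nonneg (Y i)).mp h0 k (Finset.mem_univ k)))

/-- Dual basis: `|u| = 1`, `X ⊥ u`, `Y ⊥ X` ⇒ `|X|²·(u × Y) = −(Y·(u × X))·X`. [bookkeeping] -/
theorem normSq_mul_cross (hu1 : ∑ i, u i ^ 2 = 1) (huX : ∑ i, u i * X i = 0)
    (hXY : ∑ k, X k * Y k = 0) (i : Fin 3) :
    (∑ k, X k ^ 2) * r i = -(Y 0 * (u 1 * X 2 - u 2 * X 1) + Y 1 * (u 2 * X 0 - u 0 * X 2)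
      + Y 2 * (u 0 * X 1 - u 1 * X 0)) * X i := by
  simp only [Fin.sum_univ_three] at hu1 huX hXY ⊢
  fin_cases i <;> simp only [Fin.reduceFinMk, Fin.isValue, hr0, hr1, hr2]
  · linear_combination (-((u 1 * Y 2 - u 2 * Y 1) * (X 0 ^ 2 + X 1 ^ 2 + X 2 ^ 2)
        + (Y 0 * (u 1 * X 2 - u 2 * X 1) + Y 1 * (u 2 * X 0 - u 0 * X 2)
          + Y 2 * (u 0 * X 1 - u 1 * X 0)) * X 0)) * hu1
      + ((u 1 * Y 2 - u 2 * Y 1) * (u 0 * X 0 + u 1 * X 1 + u 2 * X 2)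
        + (Y 0 * (u 1 * X 2 - u 2 * X 1) + Y 1 * (u 2 * X 0 - u 0 * X 2)
          + Y 2 * (u 0 * X 1 - u 1 * X 0)) * u 0
        - (u 0 * Y 0 + u 1 * Y 1 + u 2 * Y 2) * (u 1 * X 2 - u 2 * X 1)) * huX
      + ((u 0 ^ 2 + u 1 ^ 2 + u 2 ^ 2) * (u 1 * X 2 - u 2 * X 1)) * hXY
  · linear_combination (-((u 2 * Y 0 - u 0 * Y 2) * (X 0 ^ 2 + X 1 ^ 2 + X 2 ^ 2)
        + (Y 0 * (u 1 * X 2 - u 2 * X 1) + Y 1 * (u 2 * X 0 - u 0 * X 2)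
          + Y 2 * (u 0 * X 1 - u 1 * X 0)) * X 1)) * hu1
      + ((u 2 * Y 0 - u 0 * Y 2) * (u 0 * X 0 + u 1 * X 1 + u 2 * X 2)
        + (Y 0 * (u 1 * X 2 - u 2 * X 1) + Y 1 * (u 2 * X 0 - u 0 * X 2)
          + Y 2 * (u 0 * X 1 - u 1 * X 0)) * u 1
        - (u 0 * Y 0 + u 1 * Y 1 + u 2 * Y 2) * (u 2 * X 0 - u 0 * X 2)) * huX
      + ((u 0 ^ 2 + u 1 ^ 2 + u 2 ^ 2) * (u 2 * X 0 - u 0 * X 2)) * hXY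
  · linear_combination (-((u 0 * Y 1 - u 1 * Y 0) * (X 0 ^ 2 + X 1 ^ 2 + X 2 ^ 2)
        + (Y 0 * (u 1 * X 2 - u 2 * X 1) + Y 1 * (u 2 * X 0 - u 0 * X 2)
          + Y 2 * (u 0 * X 1 - u 1 * X 0)) * X 2)) * hu1
      + ((u 0 * Y 1 - u 1 * Y 0) * (u 0 * X 0 + u 1 * X 1 + u 2 * X 2)
        + (Y 0 * (u 1 * X 2 - u 2 * X 1) + Y 1 * (u 2 * X 0 - u 0 * X 2)
          + Y 2 * (u 0 * X 1 - u 1 * X 0)) * u 2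
        - (u 0 * Y 0 + u 1 * Y 1 + u 2 * Y 2) * (u 0 * X 1 - u 1 * X 0)) * huX
      + ((u 0 ^ 2 + u 1 ^ 2 + u 2 ^ 2) * (u 0 * X 1 - u 1 * X 0)) * hXY

/-- **(R33, algebra) `r = u × Y` IS A RULING JET DIRECTION**: `|u| = 1`; a ruling jet direction
`X ≠ 0` (`u·X = 0`, `∑ₖ X_k c_{k,l} = 0`; K84: one always exists) and `Y ⊥ X` ⇒
`∑ₖ r_k c_{k,l} = 0` for every `l` (and `u·r = 0` by `cross_dot_axis`). [ours] -/
theorem cross_ruling {c : Fin 3 → Fin 3 → ℝ} (hu1 : ∑ i, u i ^ 2 = 1)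
    (huX : ∑ i, u i * X i = 0) (hXc : ∀ l, ∑ k, X k * c k l = 0) (hX : X ≠ 0)
    (hXY : ∑ k, X k * Y k = 0) (l : Fin 3) : ∑ k, r k * c k l = 0 := by
  have hX2 : ∑ k, X k ^ 2 ≠ 0 := fun h0 => hX (funext fun k => pow_eq_zero_iff two_ne_zero |>.mp
    ((Finset.sum_eq_zero_iff_of_nonneg fun i _ => sq_nonneg (X i)).mp h0 k (Finset.mem_univ k)))
  have h : (∑ k, X k ^ 2) * ∑ k, r k * c k l
      = -(Y 0 * (u 1 * X 2 - u 2 * X 1) + Y 1 * (u 2 * X 0 - u 0 * X 2)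
        + Y 2 * (u 0 * X 1 - u 1 * X 0)) * ∑ k, X k * c k l := by
    rw [Finset.mul_sum, Finset.mul_sum]
    exact Finset.sum_congr rfl fun k _ => by
      rw [← mul_assoc, normSq_mul_cross hr0 hr1 hr2 hu1 huX hXY k, mul_assoc]
  rw [hXc l, mul_zero] at h
  exact (mul_eq_zero.mp h).resolve_left hX2

end Cross

end TopEig.Ruling

end Summit.NavierStokesRegularity.FunctionalMining

end
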